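import Literature.NumberTheory.EllipticCurves.KummerMap
import Literature.NumberTheory.EllipticCurves.MordellWeil
import HarnessLib

/-!
# BirchSwinnertonDyer — SEL2CUBIC, towards the NODAL rows: local representatives with `y ≠ 0`

HONEST FRAMING: route `ShaPrimaryTransfer`, seat `bsd-line-spt-p1` (g32), `--supports` item T =
`FiniteShaComponentTransfer` (stmt-22356), UNCHANGED (conjecture-grade at corank ≥ 2). BSD in rank ≥ 2 is NOT
proved by any of this. THEOREMS ONLY.

The Selmer-ready nodal lemma (`…SelmerCubicNodalLocal.uvecOdd_mem_splitImgOdd_local`) needs a point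
`(x, y) ∈ E(ℚ_ℓ)` with `y ≠ 0` carrying the local class of the Selmer element; the local class is only defined modulo
`2E(ℚ_ℓ)`, and the point delivered by `exists_resTorsion_eq_kummerMapTorsion_of_mem_selmerGroup` may be `O` or a
`2`-torsion point `(e_i, 0)`. This file supplies the repair with no formal-group input: on `y² = x³ + Ax² + Bx + C`
the points `O` and `(x, 0)` are killed by `2`, so for ANY `Q` with `4Q ≠ O` one of `P`, `P + 2Q` is affine with `y ≠ 0`
(**`exists_rep_y_ne_zero`**), the Kummer class being unchanged (**`kummerMapTorsion_add_two_nsmul`**); and such a `Q`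
exists in `E(F)` for every field `F ⊇ ℚ` as soon as `rank E(ℚ) ≥ 1` — a rational point of infinite order
(**`exists_point_forall_nsmul_ne_zero`**, `rank = finrank_ℤ E(ℚ)`) base-changed along `ℚ → F`
(**`exists_baseChange_point_four_nsmul_ne_zero`**, `Affine.Point.map` injective). The census rows all carry `2 ≤ rank`.
[cite: SilvermanAEC2009, III.2.3, VIII.§2, VIII.6]
-/

-- single-conjunct summit: `Summit.BirchSwinnertonDyer.BirchSwinnertonDyer.…` repeats the name by design
set_option linter.dupNamespace false

noncomputable section

open scoped Classical

namespace Summit.BirchSwinnertonDyer.BirchSwinnertonDyer.Theorems.ShaPrimaryTransferSelmerCubicNodal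

open WeierstrassCurve Literature.NumberTheory.EllipticCurves

/-- **Positive rank gives a rational point of infinite order** (`rank_ℤ E(K) = finrank_ℤ E(K) ≥ 1` forbids `E(K)` from
being torsion, `rank_eq_zero_iff`); stated with natural multiples. [cite: SilvermanAEC2009, VIII.6] -/
theorem exists_point_forall_nsmul_ne_zero {K : Type*} [Field K] (E : WeierstrassCurve K)
    (h : 1 ≤ E.mordellWeilRank) : ∃ Q : E.toAffine.Point, ∀ n : ℕ, n ≠ 0 → n • Q ≠ 0 := by
  by_contra hall
  push Not at hall
  have h0 : Module.rank ℤ E.toAffine.Point = 0 := by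
    rw [rank_eq_zero_iff]
    intro x
    obtain ⟨n, hn, hnx⟩ := hall x
    exact ⟨n, by exact_mod_cast hn, by rw [natCast_zsmul]; exact hnx⟩
  have : Module.finrank ℤ E.toAffine.Point = 0 := Module.finrank_eq_zero_of_rank_eq_zero h0
  unfold WeierstrassCurve.mordellWeilRank at h
  omega

/-- **A point of `E(F)` not killed by `4`**, for any field `F ⊇ ℚ`, from `rank E(ℚ) ≥ 1` (base change of a rational
point of infinite order along `ℚ → F`; `Affine.Point.map` is injective). [cite: SilvermanAEC2009, VIII.6] -/
theorem exists_baseChange_point_four_nsmul_ne_zero (E : WeierstrassCurve ℚ) (h : 1 ≤ E.mordellWeilRank)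
    (F : Type*) [Field F] [Algebra ℚ F] :
    ∃ Q : (E.baseChange F).toAffine.Point, (4 : ℕ) • Q ≠ 0 := by
  have e : E.baseChange ℚ = E := by
    rw [WeierstrassCurve.baseChange, Algebra.algebraMap_self, WeierstrassCurve.map_id]
  have h1 : 1 ≤ (E.baseChange ℚ).mordellWeilRank := by rw [e]; exact h
  obtain ⟨Q, hQ⟩ := exists_point_forall_nsmul_ne_zero (E.baseChange ℚ) h1
  refine ⟨Affine.Point.map (W' := E) (Algebra.ofId ℚ F) Q, ?_⟩
  intro h4
  rw [← map_nsmul, ← Affine.Point.map_zero (W' := E) (Algebra.ofId ℚ F)] at h4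
  have h' := Affine.Point.map_injective (W' := E) (Algebra.ofId ℚ F) h4
  refine hQ 4 (by norm_num) ?_
  convert h'

/-- **A representative with `y ≠ 0` in a class modulo `2E(F)`.** On `y² = x³ + Ax² + Bx + C` (`a₁ = a₃ = 0`) the points
`O` and `(x, 0)` are killed by `2`; so if `4·Q ≠ O` then `P` and `P + 2Q` cannot both be of that kind: one of them is an
affine point `(x, y)` with `y ≠ 0`. [cite: SilvermanAEC2009, III.2.3] -/
theorem exists_rep_y_ne_zero {F : Type*} [Field F] (W : WeierstrassCurve F) (ha₁ : W.a₁ = 0)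
    (ha₃ : W.a₃ = 0) (P Q : W.toAffine.Point) (hQ : (4 : ℕ) • Q ≠ 0) :
    ∃ (R : W.toAffine.Point) (x y : F) (h : W.toAffine.Nonsingular x y),
      (R = P ∨ R = P + (2 : ℕ) • Q) ∧ R = .some x y h ∧ y ≠ 0 := by
  have bad : ∀ R : W.toAffine.Point, (∀ x y h, R = .some x y h → y = 0) → (2 : ℕ) • R = 0 := by
    intro R hR
    rcases R with _ | ⟨x, y, h⟩
    · exact smul_zero _
    · have hy : y = 0 := hR x y h rfl
      rw [two_nsmul]
      exact Affine.Point.add_of_Y_eq rfl (by rw [Affine.negY, hy, ha₁, ha₃]; ring)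
  by_contra hne
  push Not at hne
  have h1 : (2 : ℕ) • P = 0 := bad P fun x y h e => hne P x y h (Or.inl rfl) e
  have h2 : (2 : ℕ) • (P + (2 : ℕ) • Q) = 0 := bad _ fun x y h e => hne _ x y h (Or.inr rfl) e
  apply hQ
  rw [smul_add, h1, zero_add, ← mul_nsmul] at h2
  exact h2

/-- **The Kummer class is unchanged by adding `2Q`** (`κ` is a homomorphism with kernel `2E(F)`, tree
`kummerMapTorsion_ker`). [cite: SilvermanAEC2009, VIII.§2] -/
theorem kummerMapTorsion_add_two_nsmul {F : Type*} [Field F] [PerfectField F] (W : WeierstrassCurve F)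
    (hdiv : ∀ P : geomPoints W, ∃ Q : geomPoints W, (2 : ℤ) • Q = P) (P Q : W.toAffine.Point) :
    kummerMapTorsion W 2 hdiv (P + (2 : ℕ) • Q) = kummerMapTorsion W 2 hdiv P := by
  have h0 : kummerMapTorsion W 2 hdiv ((2 : ℕ) • Q) = 0 := by
    rw [← AddMonoidHom.mem_ker, kummerMapTorsion_ker]
    exact ⟨Q, ofNat_zsmul Q 2⟩
  rw [map_add, h0, add_zero]

/-- **Assembled: a representative with `y ≠ 0` of any class of `E(F)/2E(F)`, same Kummer class**, for `E/ℚ` of positive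
rank in the model `y² = x³ + Ax² + Bx + C` and any perfect field `F ⊇ ℚ` over which `E(F̄)` is `2`-divisible.
[cite: SilvermanAEC2009, VIII.§2] -/
theorem exists_rep_y_ne_zero_kummer (E : WeierstrassCurve ℚ) (ha₁ : E.a₁ = 0) (ha₃ : E.a₃ = 0)
    (h : 1 ≤ E.mordellWeilRank) (F : Type*) [Field F] [PerfectField F] [Algebra ℚ F]
    (hdiv : ∀ P : geomPoints (E.baseChange F), ∃ Q : geomPoints (E.baseChange F), (2 : ℤ) • Q = P)
    (P : (E.baseChange F).toAffine.Point) :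
    ∃ (x y : F) (hxy : (E.baseChange F).toAffine.Nonsingular x y), y ≠ 0 ∧
      kummerMapTorsion (E.baseChange F) 2 hdiv (.some x y hxy) = kummerMapTorsion (E.baseChange F) 2 hdiv P := by
  obtain ⟨Q, hQ⟩ := exists_baseChange_point_four_nsmul_ne_zero E h F
  obtain ⟨R, x, y, hxy, hR, hRe, hy⟩ := exists_rep_y_ne_zero (E.baseChange F) (by simp [ha₁]) (by simp [ha₃]) P Q hQ
  refine ⟨x, y, hxy, hy, ?_⟩
  rw [← hRe]
  rcases hR with rfl | rfl
  · rfl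
  · exact kummerMapTorsion_add_two_nsmul _ hdiv P Q

end Summit.BirchSwinnertonDyer.BirchSwinnertonDyer.Theorems.ShaPrimaryTransferSelmerCubicNodal

end
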